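import Literature.MathematicalPhysics.QuantumFieldTheory.SpeciesTimeReflection
import Literature.MathematicalPhysics.QuantumLattice.SchwartzOrderedWedgeDensity
import Literature.MathematicalPhysics.QuantumLattice.SchwingerOSPositivity
import HarnessLib

/-!
# Products of smeared lattice fields of Yang–Mills species; slab sums and their representatives

G-blind bookkeeping for the lattice side of `IsYangMillsFor` (`YangMillsOS`), a sequel of
`SpeciesTimeReflection` (site time reflection `Θ'`, reflection-symmetric renormalisations) used by
Osterwalder–Schrader transfer arguments on the scheme's own torus. Nothing about mass gaps is
asserted; all statements here are proved. Content:

* `timeRadius s` (largest `|x⁰|` over the support edges of a species); `obsProd S k σ f` — the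
  product `∏ⱼ Φ^{σⱼ}_{a_k}(fⱼ)(Ũ)` of smeared renormalised fields on the periodic lift `Ũ` (the
  integrand of `latticeSchwinger`; measurable, bounded); `torusTimeShift Sd m` — the torus time
  translation `(τ_m U)(x, i) = U(x + m e₀, i)` of `latticeConnectedCorr` (`torusLift_torusTimeShift`);
* the pointwise identities: REFLECTION `Φ^{s}(θf)(Ũ) = Φ^{Θs}(f)((Θ'U)~)` for symmetric
  renormalisations (`smearedLatticeField_thetaTest_torusLift`, `prod_smearedLatticeField_reflected`),
  TRANSLATION `Φ(T_{a s} g)(Ũ) = Φ(g)((τ_s U)~)` once the translated slab still fits in the box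
  (`smearedLatticeField_translateTest_torusLift`), SUPPORT: a field smeared with `f` supported in
  `lo ≤ x⁰ ≤ hi`, `lo ≥ a (R + 1)` depends only on the links at lattice times `1 … w`,
  `a w ≥ hi + a R` (`dependsOn_smearedLatticeField_torusLift`);
* `SlabSum n` — finite linear combinations `Σᵢ cᵢ Pᵢ` of slab-ordered real product tensors with
  chosen factors (`SlabSum.exists_of_mem_span`: every element of `span (slabOrderedProducts 4 n)`),
  `osAdjoint` of such sums, and the lattice representative `SlabSum.rep D S σ k = Σᵢ cᵢ obsProd S k σ fᵢ`
  (measurable, bounded, slab-supported `SlabSum.dependsOn_rep`, `SlabSum.integral_rep`).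

Conventions as in `SpeciesTimeReflection` (time = coordinate `0`, site reflection). References:
K. Osterwalder, E. Seiler, Ann. Phys. 110 (1978) 440, §2; J. Glimm, A. Jaffe, Quantum Physics (1987)
§6.1; K. Osterwalder, R. Schrader, Comm. Math. Phys. 31 (1973) 83, §2.
-/

open scoped SchwartzMap Topology ComplexConjugate
open Filter Set MeasureTheory
open Literature.Probability.LatticeModels (box mem_box Torus.proj Torus.proj_apply)
open Literature.MathematicalPhysics.AQFT Literature.MathematicalPhysics.QuantumLattice

noncomputable section

namespace Literature.MathematicalPhysics.QuantumFieldTheory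

/-! ### Products of smeared lattice fields on the torus -/

section Obs

variable {G : Type} [Group G] [MeasurableSpace G]

/-- The **time radius** of a species: the largest `|x⁰|` over the base points of its support
edges. [folklore] -/
def timeRadius (s : YMSpecies G) : ℕ := s.supp.sup fun e => (e.1 0).natAbs

/-- Every support edge of `s` has `|x⁰| ≤ timeRadius s`. [folklore] -/
theorem abs_le_timeRadius (s : YMSpecies G)
    {e : Literature.MathematicalPhysics.QuantumLattice.ZdEdge 4} (he : e ∈ s.supp) :
    |e.1 0| ≤ (timeRadius s : ℤ) := by
  rw [← Int.natCast_natAbs]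
  exact_mod_cast Finset.le_sup
    (f := fun e : Literature.MathematicalPhysics.QuantumLattice.ZdEdge 4 => (e.1 0).natAbs) he

/-- **The lattice representative of a real product tensor**: the product `∏ⱼ Φ^{σⱼ}_{a_k}(fⱼ)(Ũ)`
of the smeared renormalised fields of the species string `σ` at step `k` of `S`, read on the
periodic lift `Ũ` of the torus configuration `U` (the integrand of `latticeSchwinger`). [cite: JaffeWitten2000, §6] -/
def obsProd (S : SpeciesScheme (YMSpecies G)) (k : ℕ) {n : ℕ} (σ : Fin n → YMSpecies G)
    (f : Fin n → 𝓢(EuclideanSpace ℝ (Fin 4), ℝ)) (U : GaugeConfig 4 (S.side k) G) : ℝ :=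
  ∏ j, smearedLatticeField (σ j).F (box 4 (S.L k)) (S.a k) (S.c (σ j) k) (S.m (σ j) k) (f j)
    (torusLift (S.side k) U)

/-- **The torus time translation** by `m` lattice units, `(τ_m U)(x, i) = U(x + m e₀, i)` — the
translation of `latticeConnectedCorr` (`torusLift_torusTimeShift`), as a measurable equivalence
(tree `torusConfigShift` by `-m e₀ mod Sd`). [cite: OsterwalderSeiler1978, §2] -/
def torusTimeShift (Sd m : ℕ) : GaugeConfig 4 Sd G ≃ᵐ GaugeConfig 4 Sd G :=
  torusConfigShift (Torus.proj Sd (-(Pi.single 0 (m : ℤ))))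

omit [Group G] in
/-- The periodic lift of `τ_m U` is the `ℤ⁴`-translate `configShift (-m e₀)` of the lift of `U`
(the convention of `latticeConnectedCorr`). [folklore] -/
theorem torusLift_torusTimeShift (Sd m : ℕ) (U : GaugeConfig 4 Sd G) :
    torusLift Sd (torusTimeShift Sd m U) = configShift (-(Pi.single 0 (m : ℤ))) (torusLift Sd U) := by
  have h := congrFun (toTorusObservable_comp_configShift Sd
    (-(Pi.single (0 : Fin 4) (m : ℤ) : Literature.Probability.LatticeModels.Site 4))
    (id : LGConfig 4 G → LGConfig 4 G)) U
  simp only [toTorusObservable, Function.comp_apply, id_eq] at h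
  unfold torusTimeShift
  exact h.symm

omit [Group G] in
/-- `τ_0 = id`. [folklore] -/
@[simp] theorem torusTimeShift_zero_apply (Sd : ℕ) (U : GaugeConfig 4 Sd G) : torusTimeShift Sd 0 U = U := by
  have h0 : Torus.proj Sd (0 : Literature.Probability.LatticeModels.Site 4) = 0 := by funext i; simp
  funext e; simp [torusTimeShift, torusConfigShift_apply, h0]

/-- A smeared lattice field read on the periodic lift is measurable in the torus configuration.
[folklore] -/
theorem measurable_smearedLatticeField_torusLift (s : YMSpecies G)
    (Λ : Finset (Literature.Probability.LatticeModels.Site 4)) (a c m : ℝ)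
    (f : 𝓢(EuclideanSpace ℝ (Fin 4), ℝ)) (Sd : ℕ) :
    Measurable fun U : GaugeConfig 4 Sd G => smearedLatticeField s.F Λ a c m f (torusLift Sd U) := by
  unfold smearedLatticeField
  refine (Finset.measurable_sum _ fun x _ => ?_).const_mul _
  exact ((s.measurable.comp ((configShift _).measurable.comp (measurable_torusLift _))).sub_const
    _).const_mul _

omit [Group G] in
/-- A smeared lattice field of a bounded observable is bounded. [folklore] -/
theorem exists_bound_smearedLatticeField {O : LGConfig 4 G → ℝ} (hO : ∃ C, ∀ U, |O U| ≤ C)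
    (Λ : Finset (Literature.Probability.LatticeModels.Site 4)) (a c m : ℝ)
    (f : 𝓢(EuclideanSpace ℝ (Fin 4), ℝ)) : ∃ B, ∀ V, |smearedLatticeField O Λ a c m f V| ≤ B := by
  obtain ⟨C, hC⟩ := hO
  refine ⟨|c * a ^ 4| * ∑ x ∈ Λ, |f (a • siteToE x)| * (C + |m|), fun V => ?_⟩
  unfold smearedLatticeField
  rw [abs_mul]
  refine mul_le_mul_of_nonneg_left ((Finset.abs_sum_le_sum_abs _ _).trans
    (Finset.sum_le_sum fun x _ => ?_)) (abs_nonneg _)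
  rw [abs_mul]
  exact mul_le_mul_of_nonneg_left ((abs_sub _ _).trans (add_le_add (hC _) le_rfl)) (abs_nonneg _)

/-- `obsProd` is measurable. [folklore] -/
theorem measurable_obsProd (S : SpeciesScheme (YMSpecies G)) (k : ℕ) {n : ℕ}
    (σ : Fin n → YMSpecies G) (f : Fin n → 𝓢(EuclideanSpace ℝ (Fin 4), ℝ)) :
    Measurable (obsProd S k σ f) :=
  Finset.measurable_prod _ fun j _ =>
    measurable_smearedLatticeField_torusLift (σ j) _ _ _ _ (f j) _

/-- `obsProd` is bounded. [folklore] -/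
theorem exists_bound_obsProd (S : SpeciesScheme (YMSpecies G)) (k : ℕ) {n : ℕ}
    (σ : Fin n → YMSpecies G) (f : Fin n → 𝓢(EuclideanSpace ℝ (Fin 4), ℝ)) :
    ∃ B, ∀ U, |obsProd S k σ f U| ≤ B := by
  choose B hB using fun j => exists_bound_smearedLatticeField (σ j).bounded (box 4 (S.L k)) (S.a k)
    (S.c (σ j) k) (S.m (σ j) k) (f j)
  refine ⟨∏ j, B j, fun U => ?_⟩
  rw [obsProd, Finset.abs_prod]
  exact Finset.prod_le_prod (fun j _ => abs_nonneg _) fun j _ => hB j _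

/-- **Support.** A field smeared with `f` supported in the slab `lo ≤ x⁰ ≤ hi`, `a (R + 1) ≤ lo`,
`hi + a R ≤ a w < a · Sd` (`R` the time radius of the species) depends only on the torus links
based at lattice times `1, …, w`. [cite: OsterwalderSeiler1978, §2] -/
theorem dependsOn_smearedLatticeField_torusLift (s : YMSpecies G) (L : ℕ) {a : ℝ} (ha : 0 < a)
    (c m : ℝ) {f : 𝓢(EuclideanSpace ℝ (Fin 4), ℝ)} {lo hi : ℝ}
    (hsupp : tsupport (f : EuclideanSpace ℝ (Fin 4) → ℝ) ⊆ {x | lo ≤ x 0 ∧ x 0 ≤ hi}) {w : ℕ}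
    (hlo : a * (timeRadius s + 1) ≤ lo) (hhi : hi + a * timeRadius s ≤ a * w) {Sd : ℕ} [NeZero Sd]
    (hw : w < Sd) :
    DependsOn (fun U : GaugeConfig 4 Sd G => smearedLatticeField s.F (box 4 L) a c m f (torusLift Sd U))
      {e | 1 ≤ (e.1 0).val ∧ (e.1 0).val ≤ w} := by
  intro U V hUV
  simp only [smearedLatticeField]
  refine congrArg (fun z : ℝ => c * a ^ 4 * z) (Finset.sum_congr rfl fun x _ => ?_)
  by_cases hx : f (a • siteToE x) = 0
  · simp [hx]
  have hx' := hsupp (subset_tsupport _ (Function.mem_support.2 hx))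
  simp only [Set.mem_setOf_eq, PiLp.smul_apply, siteToE_apply, smul_eq_mul] at hx'
  have h1 : (timeRadius s : ℝ) + 1 ≤ (x 0 : ℝ) :=
    le_of_mul_le_mul_left (hlo.trans hx'.1) ha
  have h2 : (x 0 : ℝ) + timeRadius s ≤ w := by
    refine le_of_mul_le_mul_left ?_ ha
    nlinarith [hx'.2, hhi]
  have h1' : (timeRadius s : ℤ) + 1 ≤ x 0 := by exact_mod_cast h1
  have h2' : x 0 + (timeRadius s : ℤ) ≤ w := by exact_mod_cast h2
  have hO : s.F (configShift (-x) (torusLift Sd U)) = s.F (configShift (-x) (torusLift Sd V)) := by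
    refine s.isCylinder fun e he => ?_
    simp only [configShift_apply, torusLift, Function.comp_apply]
    refine hUV _ ?_
    have hR := abs_le.1 (abs_le_timeRadius s he)
    have hz : (1 : ℤ) ≤ (e.1 - -x) 0 ∧ (e.1 - -x) 0 ≤ w := by
      simp only [Pi.sub_apply, Pi.neg_apply]
      constructor <;> omega
    have hw' : (w : ℤ) < Sd := by exact_mod_cast hw
    have hval : ((((e.1 - -x) 0 : ℤ) : ZMod Sd).val : ℤ) = (e.1 - -x) 0 := by
      rw [ZMod.val_intCast, Int.emod_eq_of_lt (by omega) (by omega)]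
    simp only [Set.mem_setOf_eq, torusEdge, Torus.proj_apply]
    constructor <;> omega
  rw [hO]

omit [Group G] in
/-- **Translation.** If `g` is supported in the slab `lo ≤ x⁰ ≤ hi`, `0 ≤ lo`, and the translated
slab still fits, `hi + a s ≤ a R`, then smearing `T_{a s} g` over the box `{-R,…,R}⁴` against the
lift of `U` is smearing `g` against the lift of `τ_s U`. [cite: OsterwalderSeiler1978, §2] -/
theorem smearedLatticeField_translateTest_torusLift (O : LGConfig 4 G → ℝ) (R : ℕ) {a : ℝ}
    (ha : 0 < a) (c m : ℝ) {g : 𝓢(EuclideanSpace ℝ (Fin 4), ℝ)} {lo hi : ℝ} (hlo : 0 ≤ lo)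
    (hsupp : tsupport (g : EuclideanSpace ℝ (Fin 4) → ℝ) ⊆ {x | lo ≤ x 0 ∧ x 0 ≤ hi}) {s : ℕ}
    (hfit : hi + a * s ≤ a * R) {Sd : ℕ} (U : GaugeConfig 4 Sd G) :
    smearedLatticeField O (box 4 R) a c m (translateTest (EuclideanSpace.single 0 (a * s)) g)
        (torusLift Sd U) =
      smearedLatticeField O (box 4 R) a c m g (torusLift Sd (torusTimeShift Sd s U)) := by
  rw [torusLift_torusTimeShift]
  simp only [smearedLatticeField]
  refine congrArg (fun z : ℝ => c * a ^ 4 * z) ?_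
  set e : Literature.Probability.LatticeModels.Site 4 := Pi.single 0 (s : ℤ) with he
  set W := torusLift Sd U
  have hpt : ∀ x : Literature.Probability.LatticeModels.Site 4,
      a • siteToE x - EuclideanSpace.single (0 : Fin 4) (a * (s : ℝ)) = a • siteToE (x - e) := by
    intro x
    ext i
    by_cases hi : i = 0
    · subst hi
      simp [he, mul_sub]
    · simp [he, hi]
  have hshift : ∀ y : Literature.Probability.LatticeModels.Site 4,
      configShift (-y) (configShift (-e) W) = configShift (-(y + e)) W := by
    intro y
    funext q
    simp only [configShift_apply, sub_neg_eq_add, add_assoc]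
  simp_rw [translateTest_apply, hpt, hshift]
  have key : ∀ y : Literature.Probability.LatticeModels.Site 4, g (a • siteToE y) ≠ 0 →
      (0 : ℤ) ≤ y 0 ∧ y 0 + s ≤ R := by
    intro y hy
    have hy' := hsupp (subset_tsupport _ (Function.mem_support.2 hy))
    simp only [Set.mem_setOf_eq, PiLp.smul_apply, siteToE_apply, smul_eq_mul] at hy'
    have h1 : (0 : ℝ) ≤ y 0 := le_of_mul_le_mul_left (by nlinarith [hy'.1]) ha
    have h2 : (y 0 : ℝ) + s ≤ R := le_of_mul_le_mul_left (by nlinarith [hy'.2]) ha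
    exact ⟨by exact_mod_cast h1, by exact_mod_cast h2⟩
  have memiff : ∀ y : Literature.Probability.LatticeModels.Site 4, g (a • siteToE y) ≠ 0 →
      (y ∈ box 4 R ↔ y + e ∈ box 4 R) := by
    intro y hy
    obtain ⟨h0, h1⟩ := key y hy
    simp only [mem_box]
    refine forall_congr' fun i => ?_
    by_cases hi : i = 0
    · subst hi
      simp only [Pi.add_apply, he, Pi.single_eq_same]
      omega
    · simp [he, hi]
  refine Finset.sum_bij_ne_zero (fun x _ _ => x - e) (fun x hx hne => ?_)
    (fun x₁ _ _ x₂ _ _ h => sub_left_inj.1 h) (fun y hy hne => ?_) (fun x _ _ => ?_)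
  · have hg : g (a • siteToE (x - e)) ≠ 0 := left_ne_zero_of_mul hne
    exact (memiff _ hg).2 (by rwa [sub_add_cancel])
  · refine ⟨y + e, (memiff _ (left_ne_zero_of_mul hne)).1 hy, ?_, add_sub_cancel_right y e⟩
    rwa [add_sub_cancel_right]
  · rw [sub_add_cancel]

variable [MeasurableInv G]

/-- **Reflection** (symmetric renormalisations): `Φ^{s}(θf)(Ũ) = Φ^{Θs}(f)((Θ'U)~)` — the field of
`s` smeared with `θf` is the field of `Θs` smeared with `f` on the reflected configuration. [cite: OsterwalderSeiler1978, §2] -/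
theorem smearedLatticeField_thetaTest_torusLift {S : SpeciesScheme (YMSpecies G)}
    (hsym : S.IsReflectionSymmetric) (s : YMSpecies G) (k : ℕ)
    (f : 𝓢(EuclideanSpace ℝ (Fin 4), ℝ)) (U : GaugeConfig 4 (S.side k) G) :
    smearedLatticeField s.F (box 4 (S.L k)) (S.a k) (S.c s k) (S.m s k) (thetaTest 4 f)
        (torusLift (S.side k) U) =
      smearedLatticeField s.timeReflect.F (box 4 (S.L k)) (S.a k) (S.c s.timeReflect k)
        (S.m s.timeReflect k) f (torusLift (S.side k) U.negReflect) := by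
  rw [smearedLatticeField_thetaTest, torusLift_negReflect, (hsym s k).1, (hsym s k).2]
  rfl

/-- The reflected block of a lattice Schwinger integrand: the product over the reversed, reflected
species string against the reflected test functions is `obsProd S k σ f` read on `Θ'U`.
[cite: OsterwalderSeiler1978, §2] -/
theorem prod_smearedLatticeField_reflected {S : SpeciesScheme (YMSpecies G)}
    (hsym : S.IsReflectionSymmetric) (k : ℕ) {n : ℕ} (σ : Fin n → YMSpecies G)
    (f : Fin n → 𝓢(EuclideanSpace ℝ (Fin 4), ℝ)) (U : GaugeConfig 4 (S.side k) G) :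
    ∏ i : Fin n, smearedLatticeField (σ (Fin.rev i)).timeReflect.F (box 4 (S.L k)) (S.a k)
        (S.c (σ (Fin.rev i)).timeReflect k) (S.m (σ (Fin.rev i)).timeReflect k)
        (thetaTest 4 (f (Fin.rev i))) (torusLift (S.side k) U) =
      obsProd S k σ f U.negReflect := by
  rw [obsProd]
  refine Fintype.prod_equiv Fin.revPerm _ _ fun i => ?_
  rw [Fin.revPerm_apply, smearedLatticeField_thetaTest_torusLift hsym]
  simp only [LocalGaugeObservable.timeReflect_timeReflect]

end Obs

/-! ### Slab sums and their lattice representatives -/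

/-- **Slab-sum data**: a finite linear combination `Σᵢ cᵢ Pᵢ` of slab-ordered real product tensors
`Pᵢ = ⊗ⱼ fᵢⱼ` of arity `n`, with CHOSEN real factors `fᵢⱼ` supported in positive ordered time
slabs `loᵢⱼ ≤ x⁰ ≤ hiᵢⱼ` (the elements of `span (slabOrderedProducts 4 n)` with their witnesses). [cite: OsterwalderSchraderCMP1973, §2] -/
structure SlabSum (n : ℕ) where
  /-- number of terms -/
  N : ℕ
  /-- coefficients -/
  c : Fin N → ℂ
  /-- the product tensors -/
  P : Fin N → 𝓢((Fin n → EuclideanSpace ℝ (Fin 4)), ℂ)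
  /-- their real factors -/
  f : Fin N → Fin n → 𝓢(EuclideanSpace ℝ (Fin 4), ℝ)
  /-- lower slab times -/
  lo : Fin N → Fin n → ℝ
  /-- upper slab times -/
  hi : Fin N → Fin n → ℝ
  /-- `Pᵢ = ⊗ⱼ fᵢⱼ` -/
  isTensorOf : ∀ i, IsTensorOf (P i) fun j => ofRealTest (f i j)
  /-- the slabs are positive -/
  lo_pos : ∀ i j, 0 < lo i j
  /-- the slabs are ordered -/
  ord : ∀ i j j', j < j' → hi i j < lo i j'
  /-- the factors live in the slabs -/
  supp : ∀ i j, tsupport (f i j : EuclideanSpace ℝ (Fin 4) → ℝ) ⊆ {x | lo i j ≤ x 0 ∧ x 0 ≤ hi i j}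

namespace SlabSum

variable {n : ℕ}

/-- The test function `Σᵢ cᵢ Pᵢ`. [folklore] -/
def sum (D : SlabSum n) : 𝓢((Fin n → EuclideanSpace ℝ (Fin 4)), ℂ) := ∑ i, D.c i • D.P i

/-- Every element of the span of the slab-ordered real product tensors is the sum of some slab-sum
data. [folklore] -/
theorem exists_of_mem_span {F : 𝓢((Fin n → EuclideanSpace ℝ (Fin 4)), ℂ)}
    (hF : F ∈ Submodule.span ℂ (slabOrderedProducts 4 n)) : ∃ D : SlabSum n, D.sum = F := by
  obtain ⟨N, c, P, hsum⟩ := Submodule.mem_span_set'.1 hF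
  have hP : ∀ i, ∃ (f : Fin n → 𝓢(EuclideanSpace ℝ (Fin 4), ℝ)) (lo hi : Fin n → ℝ),
      IsTensorOf (P i : 𝓢((Fin n → EuclideanSpace ℝ (Fin 4)), ℂ)) (fun j => ofRealTest (f j)) ∧
        (∀ j, 0 < lo j) ∧ (∀ j j', j < j' → hi j < lo j') ∧
        ∀ j, tsupport (f j : EuclideanSpace ℝ (Fin 4) → ℝ) ⊆ {x | lo j ≤ x 0 ∧ x 0 ≤ hi j} := by
    intro i
    obtain ⟨f, lo, hi, h1, h2, -, h4, h5⟩ := (P i).2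
    exact ⟨f, lo, hi, h1, h2, h4, h5⟩
  choose f lo hi hT hlo hord hsupp using hP
  exact ⟨⟨N, c, fun i => P i, f, lo, hi, hT, hlo, hord, hsupp⟩, hsum⟩

/-- `osAdjoint` of a finite sum. [folklore] -/
theorem osAdjoint_finset_sum {ι : Type*} (s : Finset ι)
    (F : ι → 𝓢((Fin n → EuclideanSpace ℝ (Fin 4)), ℂ)) :
    osAdjoint (∑ i ∈ s, F i) = ∑ i ∈ s, osAdjoint (F i) := by
  classical
  induction s using Finset.induction_on with
  | empty => simp [osAdjoint]
  | insert a s ha ih => rw [Finset.sum_insert ha, Finset.sum_insert ha, osAdjoint_add, ih]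

/-- `Θ(Σ cᵢ Pᵢ)* = Σ c̄ᵢ ΘPᵢ*`. [folklore] -/
theorem osAdjoint_sum (D : SlabSum n) : osAdjoint D.sum = ∑ i, conj (D.c i) • osAdjoint (D.P i) := by
  rw [sum, osAdjoint_finset_sum]
  simp_rw [osAdjoint_smul]

variable {G : Type} [Group G] [MeasurableSpace G]

/-- **The lattice representative** `Σᵢ cᵢ · obsProd S k σ fᵢ` of the slab sum `Σᵢ cᵢ Pᵢ` for the
lattice species string `σ` at step `k`. [cite: JaffeWitten2000, §6] -/
def rep (D : SlabSum n) (S : SpeciesScheme (YMSpecies G)) (σ : Fin n → YMSpecies G) (k : ℕ)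
    (U : GaugeConfig 4 (S.side k) G) : ℂ :=
  ∑ i, D.c i * ((obsProd S k σ (D.f i) U : ℝ) : ℂ)

/-- The cast product observable is measurable and bounded. [folklore] -/
theorem measurable_bdd_obsProd (S : SpeciesScheme (YMSpecies G)) (k : ℕ) (σ : Fin n → YMSpecies G)
    (f : Fin n → 𝓢(EuclideanSpace ℝ (Fin 4), ℝ)) :
    Measurable (fun U => ((obsProd S k σ f U : ℝ) : ℂ)) ∧
      ∃ B, ∀ U, ‖((obsProd S k σ f U : ℝ) : ℂ)‖ ≤ B := by
  obtain ⟨B, hB⟩ := exists_bound_obsProd S k σ f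
  exact ⟨Complex.continuous_ofReal.measurable.comp (measurable_obsProd S k σ f), B, fun U => by
    rw [Complex.norm_real, Real.norm_eq_abs]; exact hB U⟩

/-- The representative is measurable. [folklore] -/
theorem measurable_rep (D : SlabSum n) (S : SpeciesScheme (YMSpecies G)) (σ : Fin n → YMSpecies G)
    (k : ℕ) : Measurable (D.rep S σ k) :=
  Finset.measurable_sum _ fun i _ => (measurable_bdd_obsProd S k σ (D.f i)).1.const_mul _

/-- The representative is bounded. [folklore] -/
theorem exists_bound_rep (D : SlabSum n) (S : SpeciesScheme (YMSpecies G)) (σ : Fin n → YMSpecies G)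
    (k : ℕ) : ∃ B, ∀ U, ‖D.rep S σ k U‖ ≤ B := by
  choose B hB using fun i => (measurable_bdd_obsProd S k σ (D.f i)).2
  refine ⟨∑ i, ‖D.c i‖ * B i, fun U => (norm_sum_le _ _).trans (Finset.sum_le_sum fun i _ => ?_)⟩
  rw [norm_mul]
  exact mul_le_mul_of_nonneg_left (hB i U) (norm_nonneg _)

/-- **Slab support of the representative**: if every species has time radius `≤ R`, every slab
has `a_k (R + 1) ≤ lo` and `hi + a_k R ≤ a_k w`, and `w < side`, then `rep` depends only on the
links at lattice times `1, …, w`. [cite: OsterwalderSeiler1978, §2] -/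
theorem dependsOn_rep (D : SlabSum n) (S : SpeciesScheme (YMSpecies G)) (σ : Fin n → YMSpecies G)
    (k : ℕ) {R : ℕ} (hR : ∀ j, timeRadius (σ j) ≤ R) {w : ℕ}
    (hlo : ∀ i j, S.a k * (R + 1) ≤ D.lo i j) (hhi : ∀ i j, D.hi i j + S.a k * R ≤ S.a k * w)
    (hw : w < S.side k) :
    DependsOn (D.rep S σ k) {e : Edge 4 (S.side k) | 1 ≤ (e.1 0).val ∧ (e.1 0).val ≤ w} := by
  intro U V hUV
  unfold rep obsProd
  refine Finset.sum_congr rfl fun i _ => ?_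
  congr 2
  refine Finset.prod_congr rfl fun j _ => ?_
  have ha := S.a_pos k
  have hRj : (timeRadius (σ j) : ℝ) ≤ R := by exact_mod_cast hR j
  have hm := mul_le_mul_of_nonneg_left hRj ha.le
  exact dependsOn_smearedLatticeField_torusLift (σ j) (S.L k) ha _ _ (D.supp i j)
    (by nlinarith [hlo i j]) (by nlinarith [hhi i j]) hw hUV

variable [TopologicalSpace G] [IsTopologicalGroup G] [CompactSpace G] [BorelSpace G]
variable (r : LatticeRep G) {S : SpeciesScheme (YMSpecies G)}

/-- `∫ rep = Σ cᵢ ∫ obsProd fᵢ`. [folklore] -/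
theorem integral_rep (D : SlabSum n) (σ : Fin n → YMSpecies G) (k : ℕ) :
    ∫ U, D.rep S σ k U ∂(wilsonMeasure r.ρ (S.β k)) =
      ∑ i, D.c i * ∫ U, ((obsProd S k σ (D.f i) U : ℝ) : ℂ) ∂(wilsonMeasure r.ρ (S.β k)) := by
  haveI := isProbabilityMeasure_wilsonMeasure (d := 4) (L := S.side k) r.ρ r.continuous (S.β k)
  unfold rep
  rw [integral_finsetSum _ fun i _ => ?_]
  · exact Finset.sum_congr rfl fun i _ => integral_const_mul _ _
  · have h := measurable_bdd_obsProd S k σ (D.f i)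
    obtain ⟨B, hB⟩ := h.2
    exact (Integrable.of_bound h.1.aestronglyMeasurable B (Eventually.of_forall hB)).const_mul _

end SlabSum

end Literature.MathematicalPhysics.QuantumFieldTheory

end
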